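import Literature.IUT.HodgeArakelov.EtaleThetaDataOfSettingAutAction
import Literature.IUT.HodgeArakelov.CohomologyAutOuterProofs
import Literature.AnabelianGeometry.SemiGraphs.TemperedDLocTypeTransportLemmas

/-!
# [IUTchII] Prop 2.2 (i) / 3.4 (i) at the genuine data: INNER automorphisms of `Π^tp_X̲̲` act by conjugation, and
# binder (P2) reduced to the group-theoretic «`ι` regarded up to `Π_v`-conjugacy»

abc-iut cell (WAVE-5 seat abc-iut-w5-d169; holder sub-row «P34i-GENUINE-(P1)» of DAG node IUTchII:Prop3.4(i),
`plan/L6/SUBDAG-IUTchII-Prop-31-33-34.md`; L6-lead §F v1.19s).  S. Mochizuki, *Inter-universal Teichmüller theory II*,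
kurims manuscript (Dec. 2020), Prop. 2.2 (i) p. 66: "The collection of data `(Π_{v•} ⊆ Π_{v▶} ⊆ Π_v, ι)`, regarded up
to `Π_v`-conjugacy, may be reconstructed via a functorial group-theoretic algorithm from the topological group `Π_v`";
Prop. 3.1 (i) p. 87 ("[`ι` ranges] over the inversion automorphisms of Proposition 2.2, (i)"); Prop. 3.4 (i) p. 91.
Claim key `Mochizuki2012` (DISPUTED, D-0012); [EtTh] Cor. 2.18 (i) p. 60 = FACT-LIST F-0620, BY NAME.

WHAT IS PROVED (proof-only over the landed files; no definitions, no `Prop`-valued definition, no named fact), for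
the Π-intrinsic action `autAct` / `autActOfCor218i` of `EtaleThetaDataOfSettingAutAction.lean` (abc-iut-w5-d169):
* `autAct_eq_h1LimConj_of_inner` / `autActOfCor218i_eq_h1LimConj_of_inner` / `autActOfCor218i_conjCME` — an INNER
  automorphism `conj c` of `Π^tp_X̲̲` acts on `lim_J H¹(Π^tp_Ÿ̲̲ ∩ J, l·Δ_Θ)` by abc-iut-w4-d043's conjugation action
  `h1LimConj c` (its induced automorphism of `φ(Π^tp_X̲̲)` is conjugation by `φ c`; abc-iut-w6-d002's generic
  `h1LimAut_eq_h1LimConj_of_inner`, `CohomologyAutOuterProofs.lean`, consumed BY NAME);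
* **`orbitHyp_of_iotaConj`** — binder (P2) `hρ` of `EtaleLevels.prop34i_multiradiallyDefined_intrinsic`
  (`ThetaEnvDataRecordAutIntrinsic.lean`) for the inversion action `ρ := autActOfCor218i ι₀` of an automorphism `ι₀`
  of `Π^tp_X̲̲` FOLLOWS from the purely group-theoretic statement
  `∀ α ∈ Aut_top(Π^tp_X̲̲), ∃ c ∈ Π^tp_X̲̲, α ∘ ι₀ ∘ α⁻¹ = conj c ∘ ι₀ ∘ conj c⁻¹`
  — the `ι`-component of Prop. 2.2 (i)'s «regarded up to `Π_v`-conjugacy … functorial» (not typed as such by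
  abc-iut-L6-t2's `SubgraphDecomposition`, whose `corresponds` covers `Π_{v▶}`, `Π_{v•}` only; recorded on
  plan/GAP-LEDGER.md by this seat).
Nothing here takes a side on [IUTchIII] Cor. 3.12; typed ≠ proved.
-/

noncomputable section

open Topology

namespace Literature.IUT.HodgeArakelov

namespace EtaleThetaDataOfSetting

open Literature.AnabelianGeometry.EtaleTheta Literature.AnabelianGeometry.SemiGraphs CohomologySystemOfContH1
open Literature.AnabelianGeometry.SemiGraphs.Thm68Sub (conjCME conjCME_apply)

variable {p : ℕ} [Fact p.Prime] {D : Literature.AnabelianGeometry.EtaleTheta.ThetaSetting p}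
  {E : D.EtaleThetaData} {l : ℕ} (C : E.DoubleUnderline l) (hq : IsQuotientMap D.toTheta)

/-! ### 1. Inner automorphisms act by conjugation -/

section Inner

variable (α : (Pi C) ≃ₜ* (Pi C)) (hker : ∀ x, x ∈ (phi C).ker ↔ α x ∈ (phi C).ker)
  (hA : ∀ x, x ∈ (D.lDeltaTheta l).comap (phi C) ↔ α x ∈ (D.lDeltaTheta l).comap (phi C))
  (hH : ∀ x, x ∈ PiYdd C ↔ α x ∈ PiYdd C) (c : Pi C) (hαc : ∀ g, α g = c * g * c⁻¹)

include hαc in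
/-- The automorphism of `φ(Π^tp_X̲̲)` induced by `conj c` is `conj φ(c)`. [cite: Mochizuki2012, Prop 1.4 p.27] -/
theorem rangeAut_apply_of_inner (t : phiRange C) : rangeAut C α hker hq t = phiR C c * t * (phiR C c)⁻¹ := by
  obtain ⟨g, rfl⟩ := phiR_surjective C t
  rw [rangeAut_phiR, hαc, map_mul, map_mul, map_inv]

include hαc in
/-- **An inner automorphism `conj c` of `Π^tp_X̲̲` acts on `lim_J H¹(Π^tp_Ÿ̲̲ ∩ J, l·Δ_Θ)` by the conjugation action
`h1LimConj c`.** [cite: Mochizuki2012, Cor 1.12 (i) p.56] -/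
theorem autAct_eq_h1LimConj_of_inner [(PiYdd C).Normal] (x : h1Lim (phi C) (D.lDeltaTheta l) (PiYdd C) ⊥) :
    autAct C hq α hker hA hH x = h1LimConj (phi C) (D.lDeltaTheta l) (PiYdd C) c x := by
  apply (limRestrict C).injective
  rw [limRestrict_autAct, ContH1Restrict.limEquiv_h1LimConj]
  exact h1LimAut_eq_h1LimConj_of_inner (phiR C) ((D.lDeltaTheta l).subgroupOf (phiRange C)) (PiYdd C) α
    (rangeAut C α hker hq) _ _ hH c hαc (fun a _ => rangeAut_apply_of_inner C hq α hker c hαc a) (limRestrict C x)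

end Inner

section InnerCor218i

variable {N : ℕ+} (μ : D.CyclotomeMod l N)

/-- `autActOfCor218i` of an inner automorphism is the conjugation action. [cite: Mochizuki2012, Cor 1.12 (i) p.56] -/
theorem autActOfCor218i_eq_h1LimConj_of_inner [(PiYdd C).Normal] (hC : D.Compat) (hS : D.Sec2Hyps)
    (h15 : D.Prop15iii E hC) (L : C.CuspLabels) (R : RigidData.{0} N l) (hR : R = C.rigidData μ hC hS h15 L)
    (h218i : R.Cor218_i) (α : (Pi C) ≃ₜ* (Pi C)) (c : Pi C) (hαc : ∀ g, α g = c * g * c⁻¹)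
    (x : h1Lim (phi C) (D.lDeltaTheta l) (PiYdd C) ⊥) :
    autActOfCor218i C hq μ hC hS h15 L R hR h218i α x = h1LimConj (phi C) (D.lDeltaTheta l) (PiYdd C) c x :=
  autAct_eq_h1LimConj_of_inner C hq α _ _ _ c hαc x

/-- In particular for the tree's `conjCME c` (conjugation by `c` as a topological automorphism).
[cite: Mochizuki2012, Cor 1.12 (i) p.56] -/
theorem autActOfCor218i_conjCME [(PiYdd C).Normal] (hC : D.Compat) (hS : D.Sec2Hyps)
    (h15 : D.Prop15iii E hC) (L : C.CuspLabels) (R : RigidData.{0} N l) (hR : R = C.rigidData μ hC hS h15 L)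
    (h218i : R.Cor218_i) (c : Pi C) (x : h1Lim (phi C) (D.lDeltaTheta l) (PiYdd C) ⊥) :
    autActOfCor218i C hq μ hC hS h15 L R hR h218i (conjCME c) x = h1LimConj (phi C) (D.lDeltaTheta l) (PiYdd C) c x :=
  autActOfCor218i_eq_h1LimConj_of_inner C hq μ hC hS h15 L R hR h218i (conjCME c) c (fun _ => rfl) x

/-! ### 2. Binder (P2) from «`ι` regarded up to `Π_v`-conjugacy» -/

/-- **(P2) for `ρ := autActOfCor218i ι₀` from the group-theoretic conjugacy statement**: if for every topological
automorphism `α` of `Π^tp_X̲̲` the transported inversion `α ∘ ι₀ ∘ α⁻¹` is a `Π^tp_X̲̲`-CONJUGATE `conj c ∘ ι₀ ∘ conj c⁻¹`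
of `ι₀` ([IUTchII] Prop. 2.2 (i): the datum `ι`, "regarded up to `Π_v`-conjugacy", is functorial in `Π_v`), then the
action of `α` conjugates the inversion action `ρ = ρ_{ι₀}` into its `Π^tp_X̲̲`-orbit:
`ρ_α ∘ ρ = conj_c ∘ ρ ∘ conj_c⁻¹ ∘ ρ_α` — literally the binder `hρ` of abc-iut-w5-d169's
`EtaleLevels.autIsoActionOrbitI` / `prop34i_multiradiallyDefined_intrinsic`. [cite: Mochizuki2012, Prop 2.2 (i) p.66] -/
theorem orbitHyp_of_iotaConj [(PiYdd C).Normal] (hC : D.Compat) (hS : D.Sec2Hyps)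
    (h15 : D.Prop15iii E hC) (L : C.CuspLabels) (R : RigidData.{0} N l) (hR : R = C.rigidData μ hC hS h15 L)
    (h218i : R.Cor218_i) (ι₀ : (Pi C) ≃ₜ* (Pi C))
    (hconj : ∀ α : (Pi C) ≃ₜ* (Pi C), ∃ c : Pi C, ∀ g, α (ι₀ (α.symm g)) = c * ι₀ (c⁻¹ * g * c) * c⁻¹)
    (α : (Pi C) ≃ₜ* (Pi C)) :
    ∃ c : Pi C, ∀ x,
      autActOfCor218i C hq μ hC hS h15 L R hR h218i α (autActOfCor218i C hq μ hC hS h15 L R hR h218i ι₀ x) =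
        h1LimConj (phi C) (D.lDeltaTheta l) (PiYdd C) c
          (autActOfCor218i C hq μ hC hS h15 L R hR h218i ι₀
            (h1LimConj (phi C) (D.lDeltaTheta l) (PiYdd C) c⁻¹ (autActOfCor218i C hq μ hC hS h15 L R hR h218i α x))) := by
  obtain ⟨c, hc⟩ := hconj α
  refine ⟨c, fun x => ?_⟩
  have hγδ : α.symm.trans (ι₀.trans α) = (conjCME c⁻¹).trans (ι₀.trans (conjCME c)) :=
    ContinuousMulEquiv.ext fun g => by
      rw [ContinuousMulEquiv.trans_apply, ContinuousMulEquiv.trans_apply, ContinuousMulEquiv.trans_apply,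
        ContinuousMulEquiv.trans_apply, conjCME_apply, conjCME_apply, inv_inv, hc]
  have key := autActOfCor218i_congr C hq μ hC hS h15 L R hR h218i hγδ
    (autActOfCor218i C hq μ hC hS h15 L R hR h218i α x)
  rw [autActOfCor218i_trans, autActOfCor218i_trans, autActOfCor218i_trans, autActOfCor218i_trans,
    autActOfCor218i_symm, AddEquiv.symm_apply_apply, autActOfCor218i_conjCME, autActOfCor218i_conjCME] at key
  exact key

end InnerCor218i

end EtaleThetaDataOfSetting

end Literature.IUT.HodgeArakelov

end
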